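import Summits.BirchSwinnertonDyer.BirchSwinnertonDyer.Theorems.ByReductionTypeAtTwoSupersingularUnitAnchorMTClass499555e
import Summits.BirchSwinnertonDyer.BirchSwinnertonDyer.Theorems.ByReductionTypeAtTwoSupersingularUnitAnchorTP2ByName
import HarnessLib

/-!
# Crux `SupersingularRankZeroAtTwo` (item stmt-BirchSwinnertonDyer-19097, route ByReductionTypeAtTwo, rung K4): CLASS INSTANCE on the UNIT-ANCHOR
# road, `Λ`-form, MAZUR–TATE KEYED — class **499555e** (member `499555e1`, `Δ < 0`; anchor `35a1`; `ℓ* = 4`, layer `n = 4`): the `E`-side research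
# inputs are route TP2's items K3 (20308) / K4 (20309) BY NAME and the `μ`-transport is in the kernel (seat `bsd-2adic-ss-1x` GEN 6, generator `work/ua/gen_ua_byname.py`)

HONEST FRAMING (cell `bsd-2adic`, HUMAN RULINGS D-0036/D-0054/D-0074): a CLASS INSTANCE, not a booking; THEOREM ONLY; no definition, no named fact, no
instance; two hypotheses are OPEN items of route `ThetaPartnerAtTwo` by name; closes nothing by itself; BSD is NOT proved by any of this. PARTITION (D-0054):
X5@2 good-ss `a₂ = 0` UNIT-ANCHOR sub-row (class `499555e`) × `p = 2` — types-the-object-of; bears_on: K4 19097 · TP2 20308 · 20309.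
References: [BDKim2009] Cor. 2.13; [GreenbergVatsal2000] Thm. (1.4); [Kobayashi2003] Thm. 1.2, 4.1; [Kato2004Asterisque] Thm. 12.4–12.5; [BDKim2013] Cor. 3.15;
[Pollack2003] Prop. 6.18; [AbbesUllmo1996] Thm. A; [CremonaAlgorithms1997] Table 1 (499555e1, 35a1); [Miller2011LMS] Def. 1.1.
-/

set_option autoImplicit false
-- the Theorems namespace of this sub repeats the summit name by design (D-0017 nested layout)
set_option linter.dupNamespace false

noncomputable section

open scoped Classical Polynomial

open CongruenceSubgroup WeierstrassCurve Literature.NumberTheory.EllipticCurves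
  Literature.NumberTheory.EllipticCurves.ModularForms
  Literature.NumberTheory.EllipticCurves.Rank1Residual Literature.NumberTheory.EllipticCurves.Rank1Residual.Typed
  Literature.NumberTheory.EllipticCurves.Kobayashi2003 Literature.NumberTheory.EllipticCurves.IwasawaDual
  Literature.NumberTheory.IwasawaTheory
  ZpExtension Summit.BirchSwinnertonDyer.Rank1Residual Summit.BirchSwinnertonDyer.Rank1Residual.Supersingular
  Summit.BirchSwinnertonDyer.Rank1Residual.X5 Summit.BirchSwinnertonDyer.Rank1Residual.X5.O1
  Summit.BirchSwinnertonDyer.Rank1Residual.X5.Instances Summit.BirchSwinnertonDyer.Rank1Residual.X1.MuLambda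

namespace Summit.BirchSwinnertonDyer.BirchSwinnertonDyer.Theorems
namespace SSUnitAnchor

/-- **`KobayashiMainConjecture(499555e1, 2, +) ∧ BSD(499555e1, 2)` ON THE UNIT-ANCHOR ROAD — K3/K4 BY NAME AT `E`, `μ`-TRANSPORT IN THE KERNEL.**
GEN 5's display `bsdp_two_499555e1_of_unitAnchor_of_mazurTate` with, AT `E = 499555e1` (non-CM, `SSColemanRoad.not_hasCM_499555e1`; `Δ < 0`, `SSColemanRoad.M499555e1_Δ`):
the (2′) binder `hEC` and the rational Coleman–Kato package `hCK` + Kato PUB `h124`/`hX0` REPLACED by route TP2's OPEN items BY NAME `hK3 :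
SignedKatoDivisibilityUpToAtTwo` (20308) and `hK4 : SignedControlAtTwo` (20309) — the `Λ`-torsion of `X⁺_E` now comes from the anchor `A = 35a1`
through the CM-free kernel transport (`SignedTransportAtTwo.TwoCongruence.isTorsion_and_mu_eq_zero_of_twoCongruence_negDisc`), which also discharges
`hmuT`. Still displayed: PUB {`hmod`, `hGZK`, `h2`}; research AT `A` {`hECA` (2′)}, AT THE PAIR {`hlamT` (numeral `ℓ* = 4`)}; CERT {`hLA`, `hTam`, `hSha`,
layer certificate `hMT` (`n = 4`), `L(E,1) ≠ 0`}; KERNEL: `E[2] ≅ A[2]` (Tschirnhaus, imported). Via `SSUnitAnchor.bsdp_two_baseChange_int_of_unitAnchor_of_thetaPartnerItems_negDisc`.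
The two items are hypotheses; closes nothing; BSD is not proved by any of this. [cite: BDKim2009, Cor. 2.13 and Prop. 2.6] [cite: Kobayashi2003, Thm. 1.2 and Thm. 4.1]
[cite: Kato2004Asterisque, Thm. 12.4–12.5 (3)] [cite: BDKim2013, Cor. 3.15] [cite: Pollack2003, Prop. 6.18] [cite: PollackWeston2011MT, §3.1]
[cite: AbbesUllmo1996, Thm. A] [cite: CremonaAlgorithms1997, Table 1] [cite: Miller2011LMS, Def. 1.1] -/
theorem bsdp_two_499555e1_of_unitAnchor_of_thetaPartnerItems
    (hmod : nonempty_modularParametrizationData) (hGZK : rank_eq_analyticRank_of_analyticRank_le_one)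
    (hK3 : Summit.BirchSwinnertonDyer.BirchSwinnertonDyer.Theses.ThetaPartnerAtTwo.SignedKatoDivisibilityUpToAtTwo)
    (hK4 : Summit.BirchSwinnertonDyer.BirchSwinnertonDyer.Theses.ThetaPartnerAtTwo.SignedControlAtTwo)
    (hECA : letI := isElliptic_ua35a1
      ∀ (κ : ZpExtension ℚ 2) (γ : Field.absoluteGaloisGroup ℚ),
          κ.IsCyclotomic → κ.IsTopGenerator γ → Finite (((⟨0, 1, 1, 9, 1⟩ : WeierstrassCurve ℤ).baseChange ℚ).selmerGroupPInfty 2) →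
          Finite (endInvariants (conjSignedSelmerInfty ((⟨0, 1, 1, 9, 1⟩ : WeierstrassCurve ℤ).baseChange ℚ) κ 1 γ - 1)) ∧
            ∃ u : ℤ_[2]ˣ, (Nat.card (endInvariants (conjSignedSelmerInfty ((⟨0, 1, 1, 9, 1⟩ : WeierstrassCurve ℤ).baseChange ℚ) κ 1 γ - 1)) : ℚ_[2]) =
              ((u : ℤ_[2]) : ℚ_[2]) * ((2 : ℕ) : ℚ_[2]) ^ (padicValNat 2 ((⟨0, 1, 1, 9, 1⟩ : WeierstrassCurve ℤ).baseChange ℚ).tamagawaProduct) *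
                (Nat.card (((⟨0, 1, 1, 9, 1⟩ : WeierstrassCurve ℤ).baseChange ℚ).selmerGroupPInfty 2) : ℚ_[2]) *
                  (Nat.card (EndCoinvariants (conjSignedSelmerInfty ((⟨0, 1, 1, 9, 1⟩ : WeierstrassCurve ℤ).baseChange ℚ) κ 1 γ - 1)) : ℚ_[2]))
    (hLA : ((⟨0, 1, 1, 9, 1⟩ : WeierstrassCurve ℤ).baseChange ℚ).entireLFunction 1 ≠ 0)
    (hTam : ¬ 2 ∣ ((⟨0, 1, 1, 9, 1⟩ : WeierstrassCurve ℤ).baseChange ℚ).tamagawaProduct)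
    (hSha : letI := isElliptic_ua35a1
      ¬ 2 ∣ ((⟨0, 1, 1, 9, 1⟩ : WeierstrassCurve ℤ).baseChange ℚ).shaOrder)
    (hlamT : letI := SSColemanRoad.isElliptic_499555e1
      letI := isElliptic_ua35a1
      letI := SSColemanRoad.isGloballyMinimal_499555e1
      letI := isGloballyMinimal_ua35a1
      GoodSS ((⟨0, 0, 1, -164668, -68491061⟩ : WeierstrassCurve ℤ).baseChange ℚ) 2 → ((⟨0, 0, 1, -164668, -68491061⟩ : WeierstrassCurve ℤ).baseChange ℚ).frobeniusTrace 2 = 0 →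
      GoodSS ((⟨0, 1, 1, 9, 1⟩ : WeierstrassCurve ℤ).baseChange ℚ) 2 → ((⟨0, 1, 1, 9, 1⟩ : WeierstrassCurve ℤ).baseChange ℚ).frobeniusTrace 2 = 0 →
      (∃ e : WeierstrassCurve.geomTorsion ((⟨0, 0, 1, -164668, -68491061⟩ : WeierstrassCurve ℤ).baseChange ℚ) (2 : ℤ) ≃+ WeierstrassCurve.geomTorsion ((⟨0, 1, 1, 9, 1⟩ : WeierstrassCurve ℤ).baseChange ℚ) (2 : ℤ),
        ∀ (σ : Field.absoluteGaloisGroup ℚ) (P : WeierstrassCurve.geomTorsion ((⟨0, 0, 1, -164668, -68491061⟩ : WeierstrassCurve ℤ).baseChange ℚ) (2 : ℤ)),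
          e (σ • P) = σ • e P) →
      ∀ (κ : ZpExtension ℚ 2) (γ : Field.absoluteGaloisGroup ℚ), κ.IsCyclotomic → κ.IsTopGenerator γ →
      ∀ (D : SignedSelmerDualData ((⟨0, 0, 1, -164668, -68491061⟩ : WeierstrassCurve ℤ).baseChange ℚ) κ γ 1) (D' : SignedSelmerDualData ((⟨0, 1, 1, 9, 1⟩ : WeierstrassCurve ℤ).baseChange ℚ) κ γ 1)
        [Module.Finite (IwasawaAlgebra 2) D.X] [Module.Finite (IwasawaAlgebra 2) D'.X],
        Module.IsTorsion (IwasawaAlgebra 2) D.X → Module.IsTorsion (IwasawaAlgebra 2) D'.X →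
        D.mu = 0 → D'.mu = 0 → lambdaInvariant 2 D.X = lambdaInvariant 2 D'.X + 4)
    (h2 : realPeriodRat_eq_unit_mul_plusPeriod_two)
    (hMT : letI := SSColemanRoad.isElliptic_499555e1
      ∀ [NeZero (((⟨0, 0, 1, -164668, -68491061⟩ : WeierstrassCurve ℤ).baseChange ℚ).conductorNorm ℤ)]
        (f : CuspForm (Gamma0 (((⟨0, 0, 1, -164668, -68491061⟩ : WeierstrassCurve ℤ).baseChange ℚ).conductorNorm ℤ)) 2),
        IsNewformOf ((⟨0, 0, 1, -164668, -68491061⟩ : WeierstrassCurve ℤ).baseChange ℚ) f →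
      ((mazurTateElement f 2 4).map (algebraMap ℚ (PadicAlgCl 2))).supNorm = 1 ∧
        layerLambda ((mazurTateElement f 2 4).map (algebraMap ℚ (PadicAlgCl 2))) = (2 ^ 4 - 1) / 3 + 4)
    :
    ∀ (W : WeierstrassCurve ℚ) [W.IsElliptic] [W.IsGloballyMinimal],
      W = (⟨0, 0, 1, -164668, -68491061⟩ : WeierstrassCurve ℤ).baseChange ℚ → W.entireLFunction 1 ≠ 0 → KobayashiMainConjecture W 2 1 ∧ BSDp W 2 := by
  intro W _ _ hW hL
  subst hW
  haveI := isElliptic_ua35a1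
  haveI := isGloballyMinimal_ua35a1
  exact bsdp_two_baseChange_int_of_unitAnchor_of_thetaPartnerItems_negDisc _ _ hmod hGZK h2 hK3 hK4
    SSColemanRoad.not_hasCM_499555e1 hL SSColemanRoad.goodSS_two_499555e1.2.2 SSColemanRoad.goodSS_two_499555e1.2.1 (by rw [SSColemanRoad.M499555e1_Δ]; norm_num)
    hLA goodSS_two_ua35a1.2.2 goodSS_two_ua35a1.2.1 hTam hSha _ _
    tschirnhaus_root_499555e1_ua35a1 tschirnhaus_inv_499555e1_ua35a1 hECA 4 hlamT (n := 4) ⟨2, rfl⟩ hMT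

end SSUnitAnchor

end Summit.BirchSwinnertonDyer.BirchSwinnertonDyer.Theorems

end
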